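import Summits.QuantumFields.BalabanUV.Beta.FP.ChartConjugationBoundedBricks
import Summits.QuantumFields.BalabanUV.Beta.ChartConjugation

/-!
# `BalabanUV.Beta.FP.ChartConjugationBounded` — road «FP», binder row D1, sub-row **H2-ASM-5a (Kcov)**, module R6 part 2∕2: **an5's DEFECT IDENTITY
# `conj_defect` AT A BOUNDED LEG WITH A RELATIVE TWO-SIDED CHART INVERSE** — the CONSISTENCY IDENTITY of the R5′ socket
# (`KernelReflectionBoundedContact2.axisReflectionCovariant_flip_hessKer_bdd_contact₂`, fifth conjunct; `PerfectAsymptoticsBFCov.axisReflectionCovariant_flipK_PiBF_contact₂`)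
# DISCHARGED for contacts of CHART type `CtV = conjV 𝕄 X`, `CtW = conjW 𝕄 V V′ X X′ X₂ (+ a tadpole-null remainder)`

HONEST DEPENDENCY (page 1, mandatory): continuum YM on T⁴ ⇐ BetaPertH ∧ nine spine estimates (0/9 proved); BetaPertH ⇐ (D1) ∧ (D4) ∧ CAP+tail;
G-an2-4 gates asym, D1 and NE2/3/4.  HONEST FRAMING (cell contract, verbatim): «discharging `BetaPertH` makes Bałaban's UV stability UNCONDITIONAL —
a real constructive-QFT result; it is NOT the continuum limit and NOT the Clay problem.»  THIS MODULE DISCHARGES NOTHING of the wall: [folklore] cyclic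
re-associations of absolutely convergent traces over R6 part 1 (`ChartConjugationBoundedBricks`) and an5's contact OBJECTS `ChartConjugation.conjV ∕ conjW₁ ∕ conjW₂ ∕ conjW`
(their `Loc`-closure BY NAME); 0 def, 0 `def … : Prop`, nothing cited, 0 sorry; 0∕4 row-D1 binders.  The inverse rules are HYPOTHESES (`comp A M = E`, `comp M A = E`,
`comp A E = A`, `comp E A = A`) — at the perfect leg they are gan24-leaf-02-g40's (P-INV) `PerfectPropagatorInverse.comp_Pker_MF ∕ comp_MF_Pker` (`E = idF`) plus the
field-block support of `Pker`; NOT asserted here.  NOT the (Kcov) instance (which still owes the CHART SHAPE of the gluon contacts: slice part = `SliceVertexReflection.sliceCt`,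
the `d d*` twin of an2's `WilsonReflectionContact.wilsonCt = conjV bhK (diagK ctGen)`; `S∞` part = N0b-S (a7) in (Sr-conj) form), NOT H2V-4, NOT D1, NOT BetaPertH, NOT continuum, NOT Clay.

ABSOLUTE RULE (cell charter, verbatim): «No internally-minted statement may enter as a cited fact. Every hypothesis is either kernel-proved in this package or a
verbatim quotation of a PUBLISHED theorem with page reference. The manuscript(s) under audit are NOT citable for their own disputed steps — they are the thing
under adjudication; programme-internal (2001/route/tribunal) claims are never citable.»

WHY.  an5's `ChartConjugation.conj_defect` ∕ `ChartConjugationRelative.conj_defect_rel` prove `tadpole A (conjW 𝕄 V V′ X X′ X₂) = bubble A (conjV 𝕄 X) V′ + bubble A V (conjV 𝕄 X′) +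
bubble A (conjV 𝕄 X) (conjV 𝕄 X′)` for a SPREAD leg `A` (`Spr`: exponential decay ⟹ `Tame`: summable rows and columns).  The leg of road FP's `PiBF` is the perfect propagator
`Pker` (`∼ ‖z‖⁻²` on `ℤ⁴`): bounded, NOT `Tame`.  With R6 part 1's bricks every trace in an5's computation is still absolutely convergent, because each product carries a
localised factor (`V, V′, X, X′, X₂ : Loc`) — so the identity holds VERBATIM for `Bdd A C`.  The statement is EXACTLY the fifth conjunct of the R5′ socket, read at
`CtVα μ y := conjV 𝕄 (X α μ y)`, `CtWα μ y ν y′ := conjW 𝕄 (V μ y) (V ν y′) (X α μ y) (X α ν y′) (X₂ α μ y ν y′) + Rm α μ y ν y′` (`consistency_contact₂_of_conj`).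

CONTENT (leg `hA : Bdd A C`; `hM : Spr M`, `hE : Spr E`; rules `hAM hMA hAE hEA`; generators `X, X′ : Loc` commuting with `E`; `X₂, V, V′, W, Rm : Loc`):
§1 **`sandwich_letter_bdd : comp (comp A (conjV M X)) A = comp X A − comp A X`** (the W1-shape letter of the first-order contact), `bubble_conjV_left_bdd`, `bubble_conjV_right_bdd`,
`tadpole_comm_pair_bdd`, `tadpole_conjW₁_bdd`; §2 `tadpole_conjW₂_bdd` (the `[𝕄, X₂]` part has tadpole `tr(E∘X₂) − tr(E∘X₂) = 0`; no commutation of `E` with `X₂` needed);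
§3 **`conj_defect_bdd`**, **`hess_conj_invariant_bdd`**, `conj_defect_rem_bdd` (tadpole-null remainder), **`consistency_contact₂_of_conj`** (the socket's fifth conjunct, by type).
Provenance: D1 formalisation swarm seat b2b-balaban-beta-d1-formalise-leaf-02 gen 10 (road FP engine lineage; sub-row H2-ASM-5a (Kcov)), 2026-08-21.
-/

noncomputable section

namespace Summit.QuantumFields.BalabanUV.Beta.FP.ChartConjugationBounded

open Finset
open scoped BigOperators
open Literature.MathematicalPhysics.QuantumFieldTheory.Balaban1983to89
open Literature.MathematicalPhysics.QuantumFieldTheory.Balaban1983to89.Beta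
open ExpKernelCalculus (MKer comp tr bubble tadpole)
open KernelWard (Bdd comp_sub_right comp_sub_left tr_sub)
open Summit.QuantumFields.BalabanUV.Beta.TameKernelCalculus (Spr Loc comp_assoc_tame)
open Summit.QuantumFields.BalabanUV.Beta.ChartConjugation (conjV conjW₁ conjW₂ conjW loc_conjV loc_conjW₁ loc_conjW₂ loc_conjW)
open Summit.QuantumFields.BalabanUV.Beta.FP.KernelWardBoundedBricks (slices_rl_bdd)
open Summit.QuantumFields.BalabanUV.Beta.FP.ChartConjugationBoundedBricks

variable {D : ℕ} {F : Type*} [Fintype F] {A M E : MKer D F} {C : ℝ}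

/-! ## §1 The sandwich letter and the first-order defects -/

/-- [folklore] **THE SANDWICH LETTER OF A CHART CONTACT, BOUNDED LEG**: `A∘(𝕄X − X𝕄)∘A = X∘A − A∘X` from the four relative rules and `E∘X = X∘E`
(the W1-shape letter `KernelWardBounded.ward_hess_bdd` consumes, with generator `−X`). -/
theorem sandwich_letter_bdd (hA : Bdd A C) (hM : Spr M) (hE : Spr E) (hAM : comp A M = E) (hMA : comp M A = E)
    (hAE : comp A E = A) (hEA : comp E A = A) {X : MKer D F} (hX : Loc X) (hEX : comp E X = comp X E) :
    comp (comp A (conjV M X)) A = comp X A - comp A X := by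
  obtain ⟨BM, hMb⟩ := Spr.bdd' hM
  obtain ⟨BE, hEb⟩ := Spr.bdd' hE
  have hMX : Loc (comp M X) := hM.comp_loc hX
  have hXM : Loc (comp X M) := hX.comp_spr hM
  obtain ⟨q₁, K₁, δ₁, hδ₁, -, r₁⟩ := rl_comp_bdd_loc hA hMX
  obtain ⟨q₂, K₂, δ₂, hδ₂, -, r₂⟩ := rl_comp_bdd_loc hA hXM
  have t1 : comp (comp A (comp M X)) A = comp X A := by
    rw [comp_assoc_bdd_spr_loc hA hM hX, hAM, hEX, ← comp_assoc_loc_spr_bdd hX hE hA, hEA]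
  have t2 : comp (comp A (comp X M)) A = comp A X := by
    rw [comp_assoc_bdd_loc_bdd hA hX hMb, ← comp_assoc_bddloc_spr_bdd hA hX hM hA, hMA, ← comp_assoc_bdd_loc_bdd hA hX hEb, ← hEX,
      comp_assoc_bdd_spr_loc hA hE hX, hAE]
  unfold conjV
  rw [comp_sub_right (slices_bdd_loc hA hMX) (slices_bdd_loc hA hXM), comp_sub_left (slices_rl_bdd r₁ hA hδ₁) (slices_rl_bdd r₂ hA hδ₂), t1, t2]

/-- [folklore] **BUBBLE WITH A FIRST-SLOT CHART CONTACT, BOUNDED LEG**: `bubble A (conjV 𝕄 X) Z = tr (X∘(A∘Z)) − tr ((A∘X)∘Z)`. -/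
theorem bubble_conjV_left_bdd (hA : Bdd A C) (hM : Spr M) (hE : Spr E) (hAM : comp A M = E) (hMA : comp M A = E)
    (hAE : comp A E = A) (hEA : comp E A = A) {X Z : MKer D F} (hX : Loc X) (hZ : Loc Z) (hEX : comp E X = comp X E) :
    bubble A (conjV M X) Z = tr (comp X (comp A Z)) - tr (comp (comp A X) Z) := by
  have hCt : Loc (conjV M X) := loc_conjV hM hX
  obtain ⟨BXA, hXA⟩ := bdd_comp_loc_bdd hX hA
  obtain ⟨BAX, hAX⟩ := bdd_comp_bdd_loc hA hX
  obtain ⟨BAZ, hAZ⟩ := bdd_comp_bdd_loc hA hZ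
  unfold ExpKernelCalculus.bubble
  rw [comp_assoc_bddloc_bdd_loc hA hCt hA hZ, sandwich_letter_bdd hA hM hE hAM hMA hAE hEA hX hEX,
    comp_sub_left (slices_bdd_loc hXA hZ) (slices_bdd_loc hAX hZ), ← comp_assoc_loc_bdd_loc hX hA hZ,
    tr_sub (summable_tr_loc_bdd hX hAZ) (summable_tr_bdd_loc hAX hZ)]

/-- [folklore] **BUBBLE WITH A SECOND-SLOT CHART CONTACT, BOUNDED LEG**: `bubble A Y (conjV 𝕄 X′) = tr ((A∘Y)∘X′) − tr ((A∘X′)∘Y)`. -/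
theorem bubble_conjV_right_bdd (hA : Bdd A C) (hM : Spr M) (hE : Spr E) (hAM : comp A M = E) (hMA : comp M A = E)
    (hAE : comp A E = A) (hEA : comp E A = A) {Y Xp : MKer D F} (hY : Loc Y) (hXp : Loc Xp) (hEXp : comp E Xp = comp Xp E) :
    bubble A Y (conjV M Xp) = tr (comp (comp A Y) Xp) - tr (comp (comp A Xp) Y) := by
  obtain ⟨BAY, hAY⟩ := bdd_comp_bdd_loc hA hY
  have h1 : bubble A Y (conjV M Xp) = bubble A (conjV M Xp) Y := by
    unfold ExpKernelCalculus.bubble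
    exact tr_comp_comm_bddloc_bddloc hA hY hA (loc_conjV hM hXp)
  rw [h1, bubble_conjV_left_bdd hA hM hE hAM hMA hAE hEA hXp hY hEXp, tr_comp_comm_loc_bdd hXp hAY]

/-- [folklore] tadpole of a commutator pair, bounded leg: `tadpole A (Y∘X − X∘Y) = tr ((A∘Y)∘X) − tr ((A∘X)∘Y)`. -/
theorem tadpole_comm_pair_bdd (hA : Bdd A C) {Y X : MKer D F} (hY : Loc Y) (hX : Loc X) :
    tadpole A (comp Y X - comp X Y) = tr (comp (comp A Y) X) - tr (comp (comp A X) Y) := by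
  obtain ⟨BX, hXb⟩ := Loc.bdd' hX
  obtain ⟨BY, hYb⟩ := Loc.bdd' hY
  unfold ExpKernelCalculus.tadpole
  rw [comp_sub_right (slices_bdd_loc hA (hY.comp hX)) (slices_bdd_loc hA (hX.comp hY)),
    tr_sub (summable_tr_bdd_loc hA (hY.comp hX)) (summable_tr_bdd_loc hA (hX.comp hY)),
    comp_assoc_bdd_loc_bdd hA hY hXb, comp_assoc_bdd_loc_bdd hA hX hYb]

/-- [folklore] **FIRST-ORDER DEFECT, BOUNDED LEG**: `tadpole A (conjW₁ V V′ X X′) = bubble A (conjV 𝕄 X) V′ + bubble A V (conjV 𝕄 X′)`. -/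
theorem tadpole_conjW₁_bdd (hA : Bdd A C) (hM : Spr M) (hE : Spr E) (hAM : comp A M = E) (hMA : comp M A = E)
    (hAE : comp A E = A) (hEA : comp E A = A) {V Vp X Xp : MKer D F} (hV : Loc V) (hVp : Loc Vp) (hX : Loc X) (hXp : Loc Xp)
    (hEX : comp E X = comp X E) (hEXp : comp E Xp = comp Xp E) :
    tadpole A (conjW₁ V Vp X Xp) = bubble A (conjV M X) Vp + bubble A V (conjV M Xp) := by
  obtain ⟨BAVp, hAVp⟩ := bdd_comp_bdd_loc hA hVp
  unfold conjW₁
  rw [tadpole_add_bdd hA ((hVp.comp hX).sub (hX.comp hVp)) ((hV.comp hXp).sub (hXp.comp hV)), tadpole_comm_pair_bdd hA hVp hX,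
    tadpole_comm_pair_bdd hA hV hXp, bubble_conjV_left_bdd hA hM hE hAM hMA hAE hEA hX hVp hEX,
    bubble_conjV_right_bdd hA hM hE hAM hMA hAE hEA hV hXp hEXp, tr_comp_comm_loc_bdd hX hAVp]

/-! ## §2 The quadratic defect -/

/-- [folklore] **QUADRATIC DEFECT, BOUNDED LEG**: `tadpole A (conjW₂ 𝕄 X X′ X₂) = bubble A (conjV 𝕄 X) (conjV 𝕄 X′)` — an5-rel's seven cyclic re-associations, each
absolutely convergent at a bounded leg; the `[𝕄, X₂]` part contributes `tr (E∘X₂) − tr (E∘X₂)`. -/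
theorem tadpole_conjW₂_bdd (hA : Bdd A C) (hM : Spr M) (hE : Spr E) (hAM : comp A M = E) (hMA : comp M A = E)
    (hAE : comp A E = A) (hEA : comp E A = A) {X Xp X₂ : MKer D F} (hX : Loc X) (hXp : Loc Xp) (hX₂ : Loc X₂)
    (hEX : comp E X = comp X E) :
    tadpole A (conjW₂ M X Xp X₂) = bubble A (conjV M X) (conjV M Xp) := by
  obtain ⟨BM, hMb⟩ := Spr.bdd' hM
  obtain ⟨BE, hEb⟩ := Spr.bdd' hE
  obtain ⟨BX, hXb⟩ := Loc.bdd' hX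
  obtain ⟨BXp, hXpb⟩ := Loc.bdd' hXp
  have hXXp : Loc (comp X Xp) := hX.comp hXp
  have hXpX : Loc (comp Xp X) := hXp.comp hX
  have hXM : Loc (comp X M) := hX.comp_spr hM
  have hXpM : Loc (comp Xp M) := hXp.comp_spr hM
  have hMXp : Loc (comp M Xp) := hM.comp_loc hXp
  have hMX₂ : Loc (comp M X₂) := hM.comp_loc hX₂
  have hX₂M : Loc (comp X₂ M) := hX₂.comp_spr hM
  have hXXpM : Loc (comp (comp X Xp) M) := hXXp.comp_spr hM
  have hXpXM : Loc (comp (comp Xp X) M) := hXpX.comp_spr hM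
  have hXMXp : Loc (comp (comp X M) Xp) := hXM.comp hXp
  have hXpMX : Loc (comp (comp Xp M) X) := hXpM.comp hX
  obtain ⟨BXpM, hXpMb⟩ := Loc.bdd' hXpM
  obtain ⟨BAX, hAX⟩ := bdd_comp_bdd_loc hA hX
  obtain ⟨B₁, hAMXp⟩ := bdd_comp_bdd_loc hA hMXp
  obtain ⟨B₂, hAXpM⟩ := bdd_comp_bdd_loc hA hXpM
  -- the six traces of the left-hand side
  have e1 : tr (comp A (comp (comp X Xp) M)) = tr (comp E (comp X Xp)) := by
    rw [← tr_comp_comm_loc_bdd hXXpM hA, ← comp_assoc_loc_spr_bdd hXXp hM hA, hMA, tr_comp_comm_loc_bdd hXXp hEb]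
  have e2 : tr (comp A (comp (comp Xp X) M)) = tr (comp E (comp Xp X)) := by
    rw [← tr_comp_comm_loc_bdd hXpXM hA, ← comp_assoc_loc_spr_bdd hXpX hM hA, hMA, tr_comp_comm_loc_bdd hXpX hEb]
  have e3 : tr (comp A (comp (comp X M) Xp)) = tr (comp (comp A X) (comp M Xp)) := by
    rw [comp_assoc_bdd_loc_bdd hA hXM hXpb, comp_assoc_bdd_loc_bdd hA hX hMb, ← comp_assoc_bddloc_spr_bdd hA hX hM hXpb]
  have e4 : tr (comp A (comp (comp Xp M) X)) = tr (comp X (comp A (comp Xp M))) := by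
    rw [comp_assoc_bdd_loc_bdd hA hXpM hXb, ← tr_comp_comm_loc_bdd hX hAXpM]
  have e5 : tr (comp A (comp M X₂)) = tr (comp E X₂) := by
    rw [comp_assoc_bdd_spr_loc hA hM hX₂, hAM]
  have e6 : tr (comp A (comp X₂ M)) = tr (comp E X₂) := by
    rw [← tr_comp_comm_loc_bdd hX₂M hA, ← comp_assoc_loc_spr_bdd hX₂ hM hA, hMA, tr_comp_comm_loc_bdd hX₂ hEb]
  -- two traces of the right-hand side
  have f1 : tr (comp X (comp A (comp M Xp))) = tr (comp E (comp Xp X)) := by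
    rw [tr_comp_comm_loc_bdd hX hAMXp, ← comp_assoc_bdd_loc_bdd hA hMXp hXb, ← comp_assoc_tame hM.tame hXp.tame hX.tame,
      comp_assoc_bdd_spr_loc hA hM hXpX, hAM]
  have f4 : tr (comp (comp A X) (comp Xp M)) = tr (comp E (comp X Xp)) := by
    rw [← comp_assoc_bdd_loc_bdd hA hX hXpMb, comp_assoc_tame hX.tame hXp.tame hM.tame]
    exact e1
  -- assembly
  have hL : tadpole A (conjW₂ M X Xp X₂) = tr (comp E (comp X Xp)) + tr (comp E (comp Xp X))
      - (tr (comp (comp A X) (comp M Xp)) + tr (comp X (comp A (comp Xp M)))) + (tr (comp E X₂) - tr (comp E X₂)) := by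
    unfold conjW₂
    rw [tadpole_add_bdd hA ((hXXpM.add hXpXM).sub (hXMXp.add hXpMX)) (hMX₂.sub hX₂M),
      tadpole_sub_bdd hA (hXXpM.add hXpXM) (hXMXp.add hXpMX), tadpole_add_bdd hA hXXpM hXpXM, tadpole_add_bdd hA hXMXp hXpMX,
      tadpole_sub_bdd hA hMX₂ hX₂M]
    unfold ExpKernelCalculus.tadpole
    rw [e1, e2, e3, e4, e5, e6]
  have hR : bubble A (conjV M X) (conjV M Xp) = tr (comp X (comp A (comp M Xp))) - tr (comp X (comp A (comp Xp M)))
      - (tr (comp (comp A X) (comp M Xp)) - tr (comp (comp A X) (comp Xp M))) := by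
    rw [bubble_conjV_left_bdd hA hM hE hAM hMA hAE hEA hX (loc_conjV hM hXp) hEX]
    unfold conjV
    rw [comp_sub_right (slices_bdd_loc hA hMXp) (slices_bdd_loc hA hXpM),
      comp_sub_right (slices_loc_bdd hX hAMXp) (slices_loc_bdd hX hAXpM),
      tr_sub (summable_tr_loc_bdd hX hAMXp) (summable_tr_loc_bdd hX hAXpM),
      comp_sub_right (slices_bdd_loc hAX hMXp) (slices_bdd_loc hAX hXpM),
      tr_sub (summable_tr_bdd_loc hAX hMXp) (summable_tr_bdd_loc hAX hXpM)]
  rw [hL, hR, f1, f4]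
  ring

/-! ## §3 The defect identity, the invariance of the one-loop Hessian form, and the R5′ socket's fifth conjunct -/

/-- [folklore] **THE DEFECT IDENTITY AT A BOUNDED LEG** (an5's `conj_defect` ∕ an5-rel's `conj_defect_rel`, `Spr A ↦ Bdd A`):
`tadpole A (conjW 𝕄 V V′ X X′ X₂) = bubble A (conjV 𝕄 X) V′ + bubble A V (conjV 𝕄 X′) + bubble A (conjV 𝕄 X) (conjV 𝕄 X′)`. -/
theorem conj_defect_bdd (hA : Bdd A C) (hM : Spr M) (hE : Spr E) (hAM : comp A M = E) (hMA : comp M A = E)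
    (hAE : comp A E = A) (hEA : comp E A = A) {V Vp X Xp X₂ : MKer D F} (hV : Loc V) (hVp : Loc Vp) (hX : Loc X) (hXp : Loc Xp)
    (hX₂ : Loc X₂) (hEX : comp E X = comp X E) (hEXp : comp E Xp = comp Xp E) :
    tadpole A (conjW M V Vp X Xp X₂) =
      bubble A (conjV M X) Vp + bubble A V (conjV M Xp) + bubble A (conjV M X) (conjV M Xp) := by
  unfold conjW
  rw [tadpole_add_bdd hA (loc_conjW₁ hV hVp hX hXp) (loc_conjW₂ hM hX hXp hX₂),
    tadpole_conjW₁_bdd hA hM hE hAM hMA hAE hEA hV hVp hX hXp hEX hEXp, tadpole_conjW₂_bdd hA hM hE hAM hMA hAE hEA hX hXp hX₂ hEX]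

/-- [folklore] **THE ASSEMBLED ONE-LOOP HESSIAN FORM IS BLIND TO CHART CONJUGATION, BOUNDED LEG** (an5's `hess_conj_invariant`, `Spr A ↦ Bdd A`):
`½·tadpole A (W + conjW 𝕄 V V′ X X′ X₂) − ½·bubble A (V + conjV 𝕄 X) (V′ + conjV 𝕄 X′) = ½·tadpole A W − ½·bubble A V V′`. -/
theorem hess_conj_invariant_bdd (hA : Bdd A C) (hM : Spr M) (hE : Spr E) (hAM : comp A M = E) (hMA : comp M A = E)
    (hAE : comp A E = A) (hEA : comp E A = A) {V Vp W X Xp X₂ : MKer D F} (hV : Loc V) (hVp : Loc Vp) (hW : Loc W) (hX : Loc X)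
    (hXp : Loc Xp) (hX₂ : Loc X₂) (hEX : comp E X = comp X E) (hEXp : comp E Xp = comp Xp E) :
    (1 / 2 : ℝ) * tadpole A (W + conjW M V Vp X Xp X₂) - (1 / 2 : ℝ) * bubble A (V + conjV M X) (Vp + conjV M Xp)
      = (1 / 2 : ℝ) * tadpole A W - (1 / 2 : ℝ) * bubble A V Vp := by
  have hcV := loc_conjV hM hX
  have hcVp := loc_conjV hM hXp
  rw [tadpole_add_bdd hA hW (loc_conjW hM hV hVp hX hXp hX₂), bubble_add_left_bdd hA hV hcV (hVp.add hcVp), bubble_add_right_bdd hA hV hVp hcVp,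
    bubble_add_right_bdd hA hcV hVp hcVp, conj_defect_bdd hA hM hE hAM hMA hAE hEA hV hVp hX hXp hX₂ hEX hEXp]
  ring

/-- [folklore] the defect identity WITH A TADPOLE-NULL LOCALISED REMAINDER in the second-order contact (an2's (Wr-conj-rem) slot). -/
theorem conj_defect_rem_bdd (hA : Bdd A C) (hM : Spr M) (hE : Spr E) (hAM : comp A M = E) (hMA : comp M A = E)
    (hAE : comp A E = A) (hEA : comp E A = A) {V Vp X Xp X₂ Rm : MKer D F} (hV : Loc V) (hVp : Loc Vp) (hX : Loc X) (hXp : Loc Xp)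
    (hX₂ : Loc X₂) (hRm : Loc Rm) (hRm0 : tadpole A Rm = 0) (hEX : comp E X = comp X E) (hEXp : comp E Xp = comp Xp E) :
    tadpole A (conjW M V Vp X Xp X₂ + Rm) =
      bubble A (conjV M X) Vp + bubble A V (conjV M Xp) + bubble A (conjV M X) (conjV M Xp) := by
  rw [tadpole_add_bdd hA (loc_conjW hM hV hVp hX hXp hX₂) hRm, hRm0, add_zero,
    conj_defect_bdd hA hM hE hAM hMA hAE hEA hV hVp hX hXp hX₂ hEX hEXp]

/-- [our object] **THE CONSISTENCY IDENTITY OF THE R5′ SOCKET, DISCHARGED FOR CHART CONTACTS** — the fifth conjunct of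
`KernelReflectionBoundedContact2.axisReflectionCovariant_flip_hessKer_bdd_contact₂` ∕ `PerfectAsymptoticsBFCov.axisReflectionCovariant_flipK_PiBF_contact₂`
BY TYPE, at `CtVα μ y := conjV 𝕄 (X μ y)` and `CtWα μ y ν y′ := conjW 𝕄 (V μ y) (V ν y′) (X μ y) (X ν y′) (X₂ μ y ν y′) + Rm μ y ν y′`:
for a BOUNDED leg `A`, spread `𝕄, E` with the four relative rules, localised vertices `V`, localised generators `X` commuting with `E`, localised `X₂`, and a
localised tadpole-null remainder `Rm`. -/
theorem consistency_contact₂_of_conj (hA : Bdd A C) (hM : Spr M) (hE : Spr E) (hAM : comp A M = E) (hMA : comp M A = E)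
    (hAE : comp A E = A) (hEA : comp E A = A) {V X : Fin D → (Fin D → ℤ) → MKer D F}
    {X₂ Rm : Fin D → (Fin D → ℤ) → Fin D → (Fin D → ℤ) → MKer D F} (hV : ∀ μ y, Loc (V μ y)) (hX : ∀ μ y, Loc (X μ y))
    (hX₂ : ∀ μ y ν y', Loc (X₂ μ y ν y')) (hEX : ∀ μ y, comp E (X μ y) = comp (X μ y) E)
    (hRmL : ∀ μ y ν y', Loc (Rm μ y ν y')) (hRm0 : ∀ μ y ν y', tadpole A (Rm μ y ν y') = 0) :
    ∀ (μ ν : Fin D) (z : Fin D → ℤ),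
      tadpole A (conjW M (V μ 0) (V ν z) (X μ 0) (X ν z) (X₂ μ 0 ν z) + Rm μ 0 ν z) =
        bubble A (conjV M (X μ 0)) (V ν z) + bubble A (V μ 0) (conjV M (X ν z)) + bubble A (conjV M (X μ 0)) (conjV M (X ν z)) :=
  fun μ ν z => conj_defect_rem_bdd hA hM hE hAM hMA hAE hEA (hV μ 0) (hV ν z) (hX μ 0) (hX ν z) (hX₂ μ 0 ν z) (hRmL μ 0 ν z)
    (hRm0 μ 0 ν z) (hEX μ 0) (hEX ν z)

end Summit.QuantumFields.BalabanUV.Beta.FP.ChartConjugationBounded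

end
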